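import Summits.RiemannHypothesis.RiemannHypothesis.Theorems.ScrewManifestCertDual

/-!
# ScrewManifestCertTopBlock — part of the integer-screw manifest-certificate development

Batch 3B, first part: the top-block design of record `D16` (110 integer-weighted edges on the top
16 nodes), `(DD*)` checked in the kernel (`topBlockDDStar_holds`), the typed statements
`TopBlockPairingNeg` / `TopBlockWavePos`, `NyquistFloorFrom` and `NyquistFloorEventually`.
(Split of `ScrewManifestCert.lean` v1.5 for the Theorems line cap; overview and file layout in
`Summits.RiemannHypothesis.RiemannHypothesis.Theorems.ScrewManifestCertDefs`.
Nothing in this file bears on the truth of RH.)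
-/

set_option linter.dupNamespace false
set_option autoImplicit false

namespace Summit.RiemannHypothesis.RiemannHypothesis.Theorems.IntegerScrew.Manifest

open Literature.NumberTheory.LFunctions Matrix

/-! ## Batch 3B (gen16) — the top-block design of record `D16`, the typed FIRST LEMMA of the
`NyquistFloor` line, and the proved reductions

MECHANISM (gen16, RH-free, prime-free).  A FIXED signed Laplacian on the TOP 16 nodes of `S_M`
(`M = N = n + 1`), `Y_N = Σ_e c_e (δ_{N−a_e} − δ_{N−b_e})(δ_{N−a_e} − δ_{N−b_e})ᵀ` with integer
weights `c_e = k_e` (110 edges, offsets `0 ≤ a_e < b_e ≤ 15`; the LP weights are `k_e/10⁶`, the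
certificate is scale-free), is a DUAL CERTIFICATE (`lapDual_sound`) against every manifest certificate of
`S_N` with frequencies in `[t_min, T]`, for EVERY `t_min > 0`, as soon as
  (DD*)  `Y_N ∈ DD*`  — a FINITE rational check, the same 16×16 block for every `N ≥ 17`
         (`TopBlockDDStar`; exact: diagonal ≥ 691/500000, off-diagonal slack ≥ 27/10⁶ in LP units);
  (NEG)  `Σ_e k_e Ψ(d_e(N)) < 0`, `d_e(N) = log(N − a_e) − log(N − b_e)` (`TopBlockPairingNeg`; for
         `N ≥ 31` every `d_e(N) < log 2`, so only the PRIME-FREE closed form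
         `zetaScrew_eq_of_abs_lt_log_two` of `Ψ` enters: the floor is driven by the log-cusp
         `Ψ(u) = (u/2) log(1/u) + αu + (7/8)u² + O(u³)`, `α = (1 − γ − log 2π)/2`, not by zeros or primes);
  (POS)  `Σ_e k_e (1 − cos(t·d_e(N))) ≥ 0` for `0 < t ≤ θ(N − s)` (`TopBlockWavePos`).
Then NO manifest certificate of `S_N` has `T ≤ θ(N − s)`: a LINEAR Nyquist floor
(`nyquistFloorFrom_of_topBlock`, PROVED).  DESIGN OF RECORD `D16` (LP `toplp3.py --L 16 --K 15 --sym`,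
cleaned `mkdesign.py`; files `pub/rh-explicit/sos/nyquist-dual/D16.json`, sha256 `1f99bd09…`):
`θ = 21/50`, `s = 8`, `N₀ = 31`, verified FLOAT-CERT (`verify2.py`: Taylor at 0 + grid with a second-order
remainder bound for (POS); prime-free Bernoulli series of `Ψ` for (NEG)) for EVERY `N ∈ [31, 300]`, every
211-th `N ≤ 3·10⁴`, every 9973-th `N ≤ 10⁶`: no failure; `max N·G_N = −0.00438` (at `N = 31`),
asymptotic profile `P(θ) = Σ c_e(1 − cos(ℓ_e θ)) > 0` on `(0, 0.42]` (margin 8.8·10⁻⁴, first zero 0.4535),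
`N·G_N = (S₁/2) log N + A_∞ + o(1) → −∞` (`S₁ = Σ c_e ℓ_e = −3261/10⁶ < 0`).  (DD*) is PROVED in the
kernel (`topBlockDDStar_holds`: `decide +kernel` on the integer 16×16 block + a zero-padding lemma).  What
is OPEN (typed below as `TopBlockD16Works`, the FIRST LEMMA of the line): the two analytic inequality
families (NEG), (POS) for ALL `N ≥ 31`.  Their status (gen16, `verify3.py`, label FLOAT-CERT): (POS) is
reduced to ONE compact 2-D check — in the variables `(φ, x) = (t/N, 1/N) ∈ [0, 21/50] × [0, 1/31]` the
function `F(φ, x) = Σ c_e (1 − cos(φ·Λ_e(x)))`, `Λ_e(x) = (log(1 − a_e x) − log(1 − b_e x))/x → ℓ_e`, is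
C² with explicit derivative bounds, and a Taylor strip `φ ≤ 0.0344` plus a 21 797-cell grid with a
second-order remainder certify `F > 0` (min margin 6.8·10⁻⁵) — this covers EVERY `N ≥ 31` at once,
including the limit `x = 0`; (NEG) is checked for EVERY integer `N ∈ [31, 10⁵]` (`max N·G_N = −0.00438`
at `N = 31`, `≤ −0.0273` for `N ≥ 1.2·10⁴`) and for `N > 10⁵` follows from the explicit TAIL LEMMA
`N·G_N ≤ (S₁/2) log N + A_∞ + (7/8)S₂⁺/N + C₃ S₃⁺/N² + (Lipschitz term) ≤ −0.027` (`A_∞ = −0.01201`,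
`S₂⁺ = Σ|c_e|ℓ_e² = 30.75`, `S₃⁺ = 252.4`, `C₃ = 1/100 ≥ sup_{u ≤ 1/10} |R₃(u)|/u³` from the Bernoulli
series of the prime-free closed form).  Kernel import of both = interval arithmetic (successor / DATA
lane).  Consequences (PROVED): `TopBlockD16Works → NyquistFloorFrom 31 (21/50·23/31)` (`c = 0.3116…`);
the residual finite range `8 ≤ M ≤ 30` collapses, by NESTEDNESS (`ManifestCertNested`), to ONE
tmin-free dual at `M = 8` (`FloorAtEight T₈`: no manifest certificate of `S_8` with `T ≤ T₈` for ANY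
`t_min > 0`; the census cell `M008-T20-dd` dual, `T₈ = 20`, extends from `[0.1, 20]` to `(0, 20]`:
`q(0⁺) = xᵀYx = 0.2968 > 0`, grid minimum `0.2954` on `(0, 0.1]`, FLOAT-CERT, `tminfree.py`), and
`nyquistFloor_of_D16_and_eight : 0 < T₈ → TopBlockD16Works → FloorAtEight T₈ → NyquistFloor`.
METHOD CEILING (gen16, elementary): for every such design the lag moment satisfies the PROFILE IDENTITY
`S₁ = Σ c_e ℓ_e = (1/4π) ∫₀^{2π} P(φ) / sin²(φ/2) dφ` (per lag: `(1 − cos ℓφ)/sin²(φ/2) = 2|Σ_{k<ℓ} e^{ikφ}|²`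
integrates to `4πℓ`; discrete form: `Σ_{k=1}^{m−1} P(2πk/m)/(2 sin²(πk/m)) = m S₁ − S₂` for `m ≥ L`), so an
eventually-valid design (`S₁ ≤ 0`, forced by (NEG) as `N → ∞`) has `P < 0` somewhere on `(0, π)`: fixed
top-block Laplacian duals give floors `θ·M` with `θ < π` ONLY — superlinear RH-free floors need duals whose
support grows with `M`.  Nothing here bears on the truth of RH. -/

section Batch3B

open Finset

/-- Number of edges of the design of record `D16`. -/
abbrev tbE : ℕ := 110

/-- D16: offset `a_e` of the first endpoint from the top node (`m = N − a_e`). -/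
def tbA : Fin tbE → ℕ :=
  ![0, 0, 0, 0, 0, 0, 0, 0, 0, 0, 0, 0, 0, 1, 1, 1, 1, 1, 1, 1, 1, 1, 1, 1, 1, 2, 2, 2, 2, 2, 2, 2, 2, 2, 2,
    2, 2, 2, 3, 3, 3, 3, 3, 3, 3, 3, 3, 3, 3, 4, 4, 4, 4, 4, 4, 4, 4, 4, 4, 5, 5, 5, 5, 5, 5, 5, 5, 5, 6, 6,
    6, 6, 6, 6, 6, 6, 7, 7, 7, 7, 7, 7, 7, 7, 8, 8, 8, 8, 8, 8, 9, 9, 9, 9, 9, 10, 10, 10, 10, 10, 11, 11, 11,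
    11, 12, 12, 12, 13, 13, 14]

/-- D16: offset `b_e` of the second endpoint (`a_e < b_e ≤ 15`). -/
def tbB : Fin tbE → ℕ :=
  ![1, 2, 3, 4, 5, 7, 8, 9, 11, 12, 13, 14, 15, 2, 3, 4, 5, 6, 8, 9, 10, 12, 13, 14, 15, 3, 4, 5, 6, 7, 8, 9,
    10, 11, 12, 13, 14, 15, 4, 5, 6, 7, 8, 10, 11, 12, 13, 14, 15, 5, 6, 7, 8, 9, 10, 11, 12, 13, 15, 6, 7, 8,
    9, 10, 11, 12, 13, 14, 7, 8, 9, 10, 11, 13, 14, 15, 8, 9, 10, 11, 12, 13, 14, 15, 9, 10, 11, 12, 13, 15,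
    10, 11, 12, 13, 14, 11, 12, 13, 14, 15, 12, 13, 14, 15, 13, 14, 15, 14, 15, 15]

/-- D16: integer edge weights `k_e = 10⁶·c_e` (sign pattern + / − / + in the lag `b_e − a_e`). -/
def tbK : Fin tbE → ℤ :=
  ![1365, 4788, -3612, -7023, -6990, 9758, 9758, 8771, -7023, -3612, -4788, -1365, 1376, 4777, 3600, -7011,
    -6979, -8760, 9747, 8760, 6979, -3600, -4777, -1354, -1365, 7023, 10434, -10402, -12183, -13170, 3500,
    12183, 10402, 10434, -1655, -8200, -4777, -4788, 9258, 9225, -11006, -11993, -11993, 9225, 9258, 5847,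
    -1655, -3600, -3612, 12637, 14417, -15404, -15404, -14417, 103, 12669, 9258, 10434, -7023, 14385, 15372,
    -14105, -14385, -12604, 103, 9225, 10402, 6979, 17152, 17152, -15574, -14385, -14417, 12183, 8760, 8771,
    18139, 17152, -14105, -15404, -11993, 3500, 9747, 9758, 17152, 15372, -15404, -11993, -13170, 9758, 14385,
    14417, -11006, -12183, -8760, 12637, 9225, -10402, -6979, -6990, 9258, 10434, -7011, -7023, 7023, 3600,
    -3612, 4777, 4788, 1365]

set_option maxRecDepth 100000 in
/-- Every left endpoint `tbA e` of the design `D16` is `< 16` (kernel `decide`). -/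
theorem tbA_lt_sixteen : ∀ e : Fin tbE, tbA e < 16 := by decide

set_option maxRecDepth 100000 in
/-- Every right endpoint `tbB e` of the design `D16` is `< 16` (kernel `decide`). -/
theorem tbB_lt_sixteen : ∀ e : Fin tbE, tbB e < 16 := by decide

set_option maxRecDepth 100000 in
/-- The edges of `D16` are oriented: `tbA e < tbB e` (kernel `decide`). -/
theorem tbA_lt_tbB : ∀ e : Fin tbE, tbA e < tbB e := by decide

/-- Real edge weights of `D16` (`c_e = k_e`; the dual certificate is scale-free). -/
noncomputable def tbC (e : Fin tbE) : ℝ := (tbK e : ℝ)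

/-- First endpoint of edge `e` as a node of `Fin n` (top node `N = n + 1` ↔ index `n − 1`): `n − 1 − a_e`. -/
def tbP (n : ℕ) (hn : 16 ≤ n) (e : Fin tbE) : Fin n := ⟨n - 1 - tbA e, by omega⟩

/-- Second endpoint of edge `e` as a node of `Fin n`: `n − 1 − b_e`. -/
def tbQ (n : ℕ) (hn : 16 ≤ n) (e : Fin tbE) : Fin n := ⟨n - 1 - tbB e, by omega⟩

/-- The log-lag of edge `e` seen from top node `N`: `d_e(N) = log(N − a_e) − log(N − b_e)`. -/
noncomputable def tbD (N : ℝ) (e : Fin tbE) : ℝ := Real.log (N - tbA e) - Real.log (N - tbB e)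

/-- The node of the embedded left endpoint of edge `e` is `log (n + 1 − tbA e)`. -/
theorem node_tbP (n : ℕ) (hn : 16 ≤ n) (e : Fin tbE) :
    node n (tbP n hn e) = Real.log ((n : ℝ) + 1 - tbA e) := by
  have ha := tbA_lt_sixteen e
  simp only [node, tbP]
  congr 1
  rw [show n - 1 - tbA e + 2 = n + 1 - tbA e by omega, Nat.cast_sub (by omega)]
  push_cast
  ring

/-- The node of the embedded right endpoint of edge `e` is `log (n + 1 − tbB e)`. -/
theorem node_tbQ (n : ℕ) (hn : 16 ≤ n) (e : Fin tbE) :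
    node n (tbQ n hn e) = Real.log ((n : ℝ) + 1 - tbB e) := by
  have hb := tbB_lt_sixteen e
  simp only [node, tbQ]
  congr 1
  rw [show n - 1 - tbB e + 2 = n + 1 - tbB e by omega, Nat.cast_sub (by omega)]
  push_cast
  ring

/-- The node difference along the embedded edge `e` is `tbD (n + 1) e`. -/
theorem node_diff_tb (n : ℕ) (hn : 16 ≤ n) (e : Fin tbE) :
    node n (tbP n hn e) - node n (tbQ n hn e) = tbD ((n : ℝ) + 1) e := by
  rw [node_tbP, node_tbQ, tbD]

/-- SUPPORT (finite, exact; PROVED below, `topBlockDDStar_holds`): the `D16` Laplacian lies in the dual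
cone `DD*` for every ambient size `n ≥ 16` (it is the same 16×16 integer block padded by zeros; exact
slacks: diagonal ≥ 1382, off-diagonal `(Y_aa + Y_bb)/2 − |Y_ab| ≥ 27`, in units of `k_e`). -/
def TopBlockDDStar : Prop := ∀ (n : ℕ) (hn : 16 ≤ n), InDDDual (lapY n tbE (tbP n hn) (tbQ n hn) tbC)

/-! ### (DD*) in the kernel: entries of `lapY`, zero-padding of a block, and the integer block check -/

/-- Entries of the signed edge vector `δ_p − δ_q`. -/
theorem edgeVec_apply {n : ℕ} (p q i : Fin n) :
    edgeVec n p q i = (if i = p then 1 else 0) - (if i = q then 1 else 0) := by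
  simp [edgeVec, Pi.single_apply]

/-- Entries of the signed-edge Laplacian `lapY` as a sum over the edges. -/
theorem lapY_apply {n E : ℕ} (p q : Fin E → Fin n) (c : Fin E → ℝ) (i j : Fin n) :
    lapY n E p q c i j = ∑ e, c e * (edgeVec n (p e) (q e) i * edgeVec n (p e) (q e) j) := by
  simp only [lapY, Matrix.sum_apply, Matrix.smul_apply, Matrix.vecMulVec_apply, smul_eq_mul]

/-- Edge vectors are preserved under an injective re-indexing of the nodes. -/
theorem edgeVec_emb {n L : ℕ} (ι : Fin L → Fin n) (hι : Function.Injective ι) (x y k : Fin L) :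
    edgeVec n (ι x) (ι y) (ι k) = edgeVec L x y k := by
  simp [edgeVec_apply, hι.eq_iff]

/-- An embedded edge vector vanishes off the image of the embedding. -/
theorem edgeVec_emb_zero {n L : ℕ} (ι : Fin L → Fin n) (x y : Fin L) (i : Fin n)
    (hi : ∀ k, ι k ≠ i) : edgeVec n (ι x) (ι y) i = 0 := by
  rw [edgeVec_apply, if_neg (fun h => hi x h.symm), if_neg (fun h => hi y h.symm), sub_zero]

/-- An embedded Laplacian agrees with the small Laplacian on the image of the embedding. -/
theorem lapY_emb_apply {n L E : ℕ} (ι : Fin L → Fin n) (hι : Function.Injective ι)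
    (a b : Fin E → Fin L) (c : Fin E → ℝ) (k l : Fin L) :
    lapY n E (ι ∘ a) (ι ∘ b) c (ι k) (ι l) = lapY L E a b c k l := by
  simp only [lapY_apply, Function.comp, edgeVec_emb ι hι]

/-- An embedded Laplacian vanishes in rows outside the image of the embedding. -/
theorem lapY_emb_zero_left {n L E : ℕ} (ι : Fin L → Fin n) (a b : Fin E → Fin L) (c : Fin E → ℝ)
    (i j : Fin n) (hi : ∀ k, ι k ≠ i) : lapY n E (ι ∘ a) (ι ∘ b) c i j = 0 := by
  simp only [lapY_apply, Function.comp, edgeVec_emb_zero ι _ _ i hi, zero_mul, mul_zero,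
    Finset.sum_const_zero]

/-- An embedded Laplacian vanishes in columns outside the image of the embedding. -/
theorem lapY_emb_zero_right {n L E : ℕ} (ι : Fin L → Fin n) (a b : Fin E → Fin L) (c : Fin E → ℝ)
    (i j : Fin n) (hj : ∀ k, ι k ≠ j) : lapY n E (ι ∘ a) (ι ∘ b) c i j = 0 := by
  simp only [lapY_apply, Function.comp, edgeVec_emb_zero ι _ _ j hj, mul_zero,
    Finset.sum_const_zero]

/-- `DD*` is preserved by zero-padding: a Laplacian on `Fin L` in `DD*`, pushed forward along an
injection `ι : Fin L → Fin n`, is in `DD*`. -/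
theorem inDDDual_emb {n L E : ℕ} (ι : Fin L → Fin n) (hι : Function.Injective ι)
    (a b : Fin E → Fin L) (c : Fin E → ℝ) (h : InDDDual (lapY L E a b c)) :
    InDDDual (lapY n E (ι ∘ a) (ι ∘ b) c) := by
  obtain ⟨hdiag, hoff⟩ := h
  have diag : ∀ i, 0 ≤ lapY n E (ι ∘ a) (ι ∘ b) c i i := by
    intro i
    by_cases hi : ∃ k, ι k = i
    · obtain ⟨k, rfl⟩ := hi
      rw [lapY_emb_apply ι hι]
      exact hdiag k
    · simp only [not_exists] at hi
      rw [lapY_emb_zero_left ι a b c i i hi]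
  refine ⟨diag, fun i j hij => ?_⟩
  by_cases hi : ∃ k, ι k = i
  · obtain ⟨k, rfl⟩ := hi
    by_cases hj : ∃ l, ι l = j
    · obtain ⟨l, rfl⟩ := hj
      rw [lapY_emb_apply ι hι, lapY_emb_apply ι hι, lapY_emb_apply ι hι]
      exact hoff k l (fun h => hij (congrArg ι h))
    · simp only [not_exists] at hj
      rw [lapY_emb_zero_right ι a b c _ j hj, abs_zero, mul_zero]
      exact add_nonneg (diag _) (diag _)
  · simp only [not_exists] at hi
    rw [lapY_emb_zero_left ι a b c i j hi, abs_zero, mul_zero]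
    exact add_nonneg (diag _) (diag _)

/-- Integer edge indicator `δ_p − δ_q`. -/
def ezZ {L : ℕ} (p q i : Fin L) : ℤ := (if i = p then 1 else 0) - (if i = q then 1 else 0)

/-- The signed Laplacian of an edge list with INTEGER weights (kernel-decidable entries). -/
def lapYZ (L E : ℕ) (p q : Fin E → Fin L) (k : Fin E → ℤ) : Matrix (Fin L) (Fin L) ℤ :=
  fun i j => ∑ e, k e * (ezZ (p e) (q e) i * ezZ (p e) (q e) j)

/-- With integer edge weights, `lapY` is the cast of the integer Laplacian `lapYZ`. -/
theorem lapY_cast {L E : ℕ} (p q : Fin E → Fin L) (k : Fin E → ℤ) (i j : Fin L) :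
    lapY L E p q (fun e => (k e : ℝ)) i j = ((lapYZ L E p q k i j : ℤ) : ℝ) := by
  rw [lapY_apply]
  simp only [lapYZ, ezZ, edgeVec_apply]
  push_cast
  rfl

/-- Integer `DD*` check ⇒ real `DD*` for the cast weights. -/
theorem inDDDual_of_int {L E : ℕ} (p q : Fin E → Fin L) (k : Fin E → ℤ)
    (h : (∀ i, 0 ≤ lapYZ L E p q k i i) ∧
      ∀ i j, i ≠ j → 2 * |lapYZ L E p q k i j| ≤ lapYZ L E p q k i i + lapYZ L E p q k j j) :
    InDDDual (lapY L E p q (fun e => (k e : ℝ))) := by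
  refine ⟨fun i => ?_, fun i j hij => ?_⟩
  · rw [lapY_cast]; exact_mod_cast h.1 i
  · rw [lapY_cast, lapY_cast, lapY_cast]; exact_mod_cast h.2 i j hij

/-- The top-`16` embedding `k ↦ n − 1 − k` (`k` = offset from the top node). -/
def topEmb (n : ℕ) (hn : 16 ≤ n) (k : Fin 16) : Fin n := ⟨n - 1 - k, by omega⟩

/-- The top-block embedding `topEmb` is injective. -/
theorem topEmb_injective (n : ℕ) (hn : 16 ≤ n) : Function.Injective (topEmb n hn) := by
  intro k l h
  have hv := congrArg Fin.val h
  simp only [topEmb] at hv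
  have hk := k.isLt
  have hl := l.isLt
  apply Fin.ext
  omega

/-- `D16` offsets as elements of `Fin 16`. -/
def tbAF (e : Fin tbE) : Fin 16 := ⟨tbA e, tbA_lt_sixteen e⟩

/-- `D16` offsets as elements of `Fin 16`. -/
def tbBF (e : Fin tbE) : Fin 16 := ⟨tbB e, tbB_lt_sixteen e⟩

/-- The left endpoints `tbP` factor through the top-block embedding. -/
theorem tbP_eq (n : ℕ) (hn : 16 ≤ n) : tbP n hn = topEmb n hn ∘ tbAF := rfl

/-- The right endpoints `tbQ` factor through the top-block embedding. -/
theorem tbQ_eq (n : ℕ) (hn : 16 ≤ n) : tbQ n hn = topEmb n hn ∘ tbBF := rfl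

/-- KERNEL CHECK (exact integer arithmetic, `decide +kernel`): the 16×16 `D16` block is in `DD*`. -/
theorem tbBlock_inDDDualZ :
    (∀ i : Fin 16, 0 ≤ lapYZ 16 tbE tbAF tbBF tbK i i) ∧
      ∀ i j : Fin 16, i ≠ j →
        2 * |lapYZ 16 tbE tbAF tbBF tbK i j| ≤ lapYZ 16 tbE tbAF tbBF tbK i i + lapYZ 16 tbE tbAF tbBF tbK j j := by
  decide +kernel

/-- PROVED (gen16): `TopBlockDDStar` — the `D16` Laplacian is in `DD*` for every `n ≥ 16`. -/
theorem topBlockDDStar_holds : TopBlockDDStar := by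
  intro n hn
  rw [tbP_eq, tbQ_eq]
  exact inDDDual_emb (topEmb n hn) (topEmb_injective n hn) tbAF tbBF tbC
    (inDDDual_of_int tbAF tbBF tbK tbBlock_inDDDualZ)

/-- FIRST-LEMMA COMPONENT (NEG), RH-free and PRIME-free for `N₀ ≥ 31`: pairing negativity of `D16`
against the screw matrix, `Σ_e k_e Ψ(log(N − a_e) − log(N − b_e)) < 0` for all `N ≥ N₀`.
Status (gen16, `verify3.py`): FLOAT every-N on `31 ≤ N ≤ 10⁵` (no failure; `max N·G_N = −0.00438` at
`N = 31`, `≤ −0.0273` for `N ≥ 1.2·10⁴`) + an explicit ANALYTIC tail lemma for `N > 10⁵`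
(`N·G_N ≤ (S₁/2) log N + A_∞ + (7/8)S₂⁺/N + C₃S₃⁺/N² + Lipschitz term ≤ −0.027`, from the Bernoulli
series of the prime-free closed form: `|R₃(u)| ≤ u³/100`, `|Ψ′(u)| ≤ ½ log(1/u) + 1.21 + 2u` on
`(0, 1/10]`).  Why it might fail: only through a numerical slip near `N = 31` (margin 0.4 % of `Σ|c_e|`),
repairable by raising `N₀` (the census duals cover `M ≤ 112`). -/
def TopBlockPairingNeg (N0 : ℕ) : Prop :=
  ∀ N : ℕ, N0 ≤ N → ∑ e, tbC e * zetaScrew (tbD N e) < 0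

/-- FIRST-LEMMA COMPONENT (POS), RH-free, elementary: wave positivity of `D16`,
`Σ_e k_e (1 − cos(t·d_e(N))) ≥ 0` for `0 < t ≤ θ(N − s)`, all `N ≥ N₀`.
Status (`θ = 21/50`, `s = 8`, `N₀ = 31`; gen16 `verify3.py`): FLOAT-CERT for ALL `N ≥ 31` at once by ONE
compact 2-D certificate in `(φ, x) = (t/N, 1/N) ∈ (0, 21/50] × [0, 1/31]` for
`F(φ, x) = Σ c_e (1 − cos(φ Λ_e(x)))`, `Λ_e(x) = (log(1 − a_e x) − log(1 − b_e x))/x`: Taylor strip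
`φ ≤ 0.0344` (`S₂(x) ≥ 0.345`) + 21 797 grid cells with an explicit second-order remainder
(`M_φφ = 56.4`, `M_φx = 359.2`, `M_xx = 2551.7`), min margin `6.8·10⁻⁵`.  Why it might fail: only
through libm rounding in a `10⁻⁵`-margin cell (an interval re-run settles it); the asymptotic profile
(`x = 0`) is positive on `(0, 0.42]` with first zero at `0.4535`. -/
def TopBlockWavePos (θ s : ℝ) (N0 : ℕ) : Prop :=
  ∀ N : ℕ, N0 ≤ N → ∀ t : ℝ, 0 < t → t ≤ θ * ((N : ℝ) - s) →
    0 ≤ ∑ e, tbC e * (1 - Real.cos (t * tbD N e))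

/-- PROVED REDUCTION: (DD*) + (NEG) + (POS) from `N₀ ≥ 17` ⇒ no manifest certificate of `S_{n+1}`,
`n + 1 ≥ N₀`, has `T ≤ θ(n + 1 − s)` — for ANY `t_min > 0`. -/
theorem topBlock_noCert {N0 : ℕ} {θ s : ℝ} (hN0 : 17 ≤ N0) (hdd : TopBlockDDStar)
    (hneg : TopBlockPairingNeg N0) (hpos : TopBlockWavePos θ s N0)
    (n : ℕ) (tmin T : ℝ) (hn : N0 ≤ n + 1) (htmin : 0 < tmin) (hT : T ≤ θ * ((n : ℝ) + 1 - s)) :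
    ¬ ManifestCert n tmin T := by
  have hn16 : 16 ≤ n := by omega
  have hcast : ((n + 1 : ℕ) : ℝ) = (n : ℝ) + 1 := by push_cast; ring
  have hd : ∀ e, node n (tbP n hn16 e) - node n (tbQ n hn16 e) = tbD ((n + 1 : ℕ) : ℝ) e := by
    intro e; rw [hcast]; exact node_diff_tb n hn16 e
  refine lapDual_sound (tbP n hn16) (tbQ n hn16) tbC htmin (hdd n hn16) ?_ ?_
  · intro t ht1 ht2
    simp_rw [hd]
    exact hpos (n + 1) (by omega) t (lt_of_lt_of_le htmin ht1) (by rw [hcast]; exact le_trans ht2 hT)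
  · simp_rw [hd]
    exact hneg (n + 1) (by omega)

/-- The linear Nyquist floor FROM `N₀` on: every manifest certificate of `S_M`, `M = n + 1 ≥ N₀`, any
`t_min > 0`, has `T ≥ c·M`.  (`NyquistFloor` = `∃ c > 0, NyquistFloorFrom 8 c`, `nyquistFloor_iff`.) -/
def NyquistFloorFrom (N0 : ℕ) (c : ℝ) : Prop :=
  ∀ (n : ℕ) (tmin T : ℝ), N0 ≤ n + 1 → 0 < tmin → ManifestCert n tmin T → c * (n + 1) ≤ T

/-- Eventual linear Nyquist floor (some `c > 0`, some `N₀`). -/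
def NyquistFloorEventually : Prop := ∃ c : ℝ, 0 < c ∧ ∃ N0 : ℕ, NyquistFloorFrom N0 c

/-- `NyquistFloor` is a floor from `N₀ = 8` on (`7 ≤ n` reads `N = n + 1 ≥ 8`). -/
theorem nyquistFloor_iff : NyquistFloor ↔ ∃ c : ℝ, 0 < c ∧ NyquistFloorFrom 8 c := by
  unfold NyquistFloor NyquistFloorFrom
  constructor
  · rintro ⟨c, hc, h⟩
    exact ⟨c, hc, fun n tmin T hn ht hm => h n tmin T (by omega) ht hm⟩
  · rintro ⟨c, hc, h⟩
    exact ⟨c, hc, fun n tmin T hn ht hm => h n tmin T (by omega) ht hm⟩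

/-- `NyquistFloor` implies its eventual form. -/
theorem nyquistFloorEventually_of_nyquistFloor (h : NyquistFloor) : NyquistFloorEventually := by
  obtain ⟨c, hc, h⟩ := nyquistFloor_iff.mp h
  exact ⟨c, hc, 8, h⟩

/-- `NyquistFloorFrom` is monotone in the threshold `N₀` and antitone in the constant `c`. -/
theorem nyquistFloorFrom_mono {N0 N1 : ℕ} {c c' : ℝ} (hN : N0 ≤ N1) (hc : c' ≤ c)
    (h : NyquistFloorFrom N0 c) : NyquistFloorFrom N1 c' := by
  intro n tmin T hn ht hm
  have hpos : (0 : ℝ) ≤ n + 1 := by positivity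
  exact le_trans (mul_le_mul_of_nonneg_right hc hpos) (h n tmin T (le_trans hN hn) ht hm)

end Batch3B

end Summit.RiemannHypothesis.RiemannHypothesis.Theorems.IntegerScrew.Manifest
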